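import Summits.Parity.GeneralizedHardyLittlewood.Theorems.LeeYangFibresRelativeDimOneDefs
import Summits.Parity.GeneralizedHardyLittlewood.Theorems.LeeYangFibresRelativeDimOneTightness
import Summits.Parity.GeneralizedHardyLittlewood.Theorems.LeeYangFibresRelativeDimOneLocalAverage
import Summits.Parity.GeneralizedHardyLittlewood.Theorems.LeeYangFibresRelativeDimOneSingularTail
import Summits.Parity.GeneralizedHardyLittlewood.Theorems.LeeYangFibresRelativeDimOneDegenerateCount
import Summits.Parity.GeneralizedHardyLittlewood.Theorems.LeeYangFibresRelativeDimOneArchFacts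
import Summits.Parity.GeneralizedHardyLittlewood.Theorems.LeeYangFibresRelativeDimOneSingularMeanGlue
import Summits.Parity.GeneralizedHardyLittlewood.Theorems.LeeYangFibresRelativeDimOneAmplification
import HarnessLib

/-!
# Line `SketchIdeator1` = card `translate-amplification` — skeleton for the crux `RelativeDimOne`
(stmt-Parity-14113), cycle-1 state: CLOSED MODULO THE ATOM

Route `LeeYangFibres` (Parity / GeneralizedHardyLittlewood), crux decl
`Summit.Parity.GeneralizedHardyLittlewood.Theses.LeeYangFibres.RelativeDimOne` (rank 9, a derived node
of open-problem strength: the `Λ`-form of Green–Tao Conj. 1.4 at `d = 1`, uniform over non-degenerate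
systems `Ψ` of `t` forms with `‖Ψ‖_N ≤ L` and convex `K ⊆ [-N, N]`, error `ε (β_∞ ∏_p β_p + N)`; it contains
the twin prime conjecture, `Theorems/LeeYangFibresRelativeDimOne.twinPrimeConjecture_of_relativeDimOne`).

THE LINE (idea card `Cruxes/RelativeDimOne/Ideas/translate-amplification.md`): the tensor-power trick over
TRANSLATE-CONSTELLATIONS `Ψ^{(H)} := Ψ ⊔ (Ψ + H₁) ⊔ ⋯ ⊔ (Ψ + H_m)` (`translateFamily Ψ H`) on
`K_H := K ∩ ⋂_j (K − H_j)` (`meetTranslates K H`). Vocabulary and the nine statements: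
`Theorems/LeeYangFibresRelativeDimOneDefs.lean` (p86258).

## Stubs — ALL PROVABLE ONES LANDED (cycle 1, 2026-08-16); what remains is the atom

* `completeSum : CompleteSum` — B1, the m-fold complete-sum identity
  `∑_{H ∈ [-2N,2N]^m} S(Ψ^{(H)}, K_H) = S(Ψ,K)^{m+1}` — PROVED, `…RelativeDimOneDefs.lean` (p86258).
* `stub_localAverage : LocalAverage` — local factors of translate-constellations multiply EXACTLY on average
  over integer boxes of side `∏ S` — LANDED `…RelativeDimOneLocalAverage.lean` (p87792).
* `stub_singularTail : SingularTail` — uniform tails `𝔖(Φ) = (1 + O(δ)) ∏_{p ≤ y_N} β_p(Φ)` for `d = 1`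
  non-degenerate systems, `y_N = ⌊log N/4⌋` — LANDED `…RelativeDimOneSingularTail.lean` (p88485).
* `stub_degenerateCount : DegenerateCount` — degenerate shifts `≤ m(m+1)t² (4N+1)^{m-1}` — LANDED
  `…RelativeDimOneDegenerateCount.lean` (p87682).
* `stub_archFacts : ArchFacts` — `∑_H vol(I_H) = vol(I)^{m+1} + O(m 2^m (N+1)^m)`, 2-Lipschitz weights —
  LANDED `…RelativeDimOneArchFacts.lean` (p89974) + `…ArchFactsAux.lean` (p88659).
* `stub_singularMeanGlue : SingularMeanGlue` — Gallagher's interchange (cubes of side `primorial y_N`) —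
  LANDED `…RelativeDimOneSingularMeanGlue.lean` (p90745) + `…Aux.lean` (p90052) + `…Aux2.lean` (p88823).
* `stub_amplification : Amplification` — THE TRANSFER
  `CompleteSum → SingularMean → DegenerateCount → CoarseHLSlack → RelativeDimOne` — LANDED
  `…RelativeDimOneAmplification.lean` (p90024) + `…AmplificationAux.lean` (p88331).
* `coarseHLSlack_of_relativeDimOne : RelativeDimOne → CoarseHLSlack` — tightness — LANDED
  `…RelativeDimOneTightness.lean` (p86661).
* `stub_coarseHLSlack : CoarseHLSlack` — THE ATOM, the only `sorry` left: coarse two-sided Hardy–Littlewood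
  with sub-exponential dimension loss and `o(N)` slack. It is EQUIVALENT to the crux
  (`relativeDimOne_iff_coarseHLSlack`, Theorems/LeeYangFibresRelativeDimOneEquivalence.lean, p90896) and therefore of open-problem
  strength (twin primes; its upper half alone forces uniform character PNT by the necessity card
  `gallagher-backwards-split`). Nobody is asked to prove it; the line's provable content is exhausted.

## Hardness certificates of the atom (cycle 2, card `gallagher-backwards-split`; namespace `…GallagherBackwards`)

* `Theorems/LeeYangFibresRelativeDimOneNecessityDefs.lean` (p91813): `classPsi`, `charPsi`, `SharpClassSecondMoment`,
  `UniformCharPNT`, `UpperRelativeDimOne`, `CoarseUpperHLSlack` (statements).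
* `upperRelativeDimOne_of_coarseUpperHLSlack : CoarseUpperHLSlack → UpperRelativeDimOne` (p92176, upper-half amplification),
  `latticeNecessity : UpperRelativeDimOne → SharpClassSecondMoment` (p92797, Gallagher's identity backwards),
  `characterNecessity : SharpClassSecondMoment → UniformCharPNT` (p92764, orthogonality + PNT),
  composed in `Theorems/LeeYangFibresRelativeDimOneHardness.lean` (p92834): `uniformCharPNT_of_coarseUpperHLSlack`,
  `uniformCharPNT_of_relativeDimOne`, `uniformCharPNT_of_coarseHLSlack` — the atom, indeed its UPPER half alone, forces
  `ψ(N, χ) = o(N)` for every non-principal character of conductor `≤ N^θ`, every `θ < 1` (GRH-lite; Siegel zeros included).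
  This is the `_false_without_`-type content every source of the atom must spend.

Disproof.lean for this crux: still none (2026-08-16T09:00Z, `ledger crux ls stmt-Parity-14113`).
-/

noncomputable section

open scoped BigOperators Classical Topology
open Finset Filter MeasureTheory Literature.NumberTheory.Sieve
open Summit.Parity.GeneralizedHardyLittlewood.Theses.LeeYangFibres (RelativeDimOne)

namespace Summit.Parity.GeneralizedHardyLittlewood.Cruxes.RelativeDimOne.TranslateAmplification

/-! ### The one remaining registered stub: the atom -/

/-- Stub ATOM (registered; open-problem strength, equivalent to the crux): coarse two-sided
Hardy–Littlewood with sub-exponential dimension loss and `o(N)` slack. -/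
theorem stub_coarseHLSlack : CoarseHLSlack := by
  sorry

/-! ### Composition (everything below the atom is kernel-checked in the tree) -/

/-- **The crux, modulo the atom**: the transfer applied to the proved complete-sum identity, the
UNCONDITIONAL Gallagher averaging (glue applied to the four landed stubs), the degenerate-shift count and
the atom — concluding `LeeYangFibres.RelativeDimOne` BY NAME. -/
theorem RelativeDimOne_of : RelativeDimOne :=
  stub_amplification completeSum
    (stub_singularMeanGlue stub_localAverage stub_singularTail stub_degenerateCount stub_archFacts)
    stub_degenerateCount stub_coarseHLSlack

/-- B2 — Gallagher averaging for translate-constellations, UNCONDITIONAL (also landed as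
`Theorems/LeeYangFibresRelativeDimOneEquivalence.singularMean`, p90896). -/
theorem singularMean' : SingularMean :=
  stub_singularMeanGlue stub_localAverage stub_singularTail stub_degenerateCount stub_archFacts

/-- The hypothetical form of the composition: the atom ALONE now implies the crux (all other inputs are
theorems of the tree); with `coarseHLSlack_of_relativeDimOne` this is the equivalence
`RelativeDimOne ↔ CoarseHLSlack` (landed as `relativeDimOne_iff_coarseHLSlack`, p90896). -/
example (hC : CoarseHLSlack) : RelativeDimOne :=
  stub_amplification completeSum singularMean' stub_degenerateCount hC

end Summit.Parity.GeneralizedHardyLittlewood.Cruxes.RelativeDimOne.TranslateAmplification
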